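import Summits.SmoothPoincare4.SmoothPoincare4.Theorems.InformationMetricHadamardAhHadamardFillingStubCollarEndHadamard
import Summits.SmoothPoincare4.SmoothPoincare4.Theorems.InformationMetricHadamardAhHadamardFillingStubFisherRaoMetric
import Summits.SmoothPoincare4.SmoothPoincare4.Theorems.InformationMetricHadamardAhHadamardFillingStubHellingerGaussEquation
import Summits.SmoothPoincare4.SmoothPoincare4.Theorems.InformationMetricHadamardAhHadamardFillingStubInstantonCollarPackage
import Summits.SmoothPoincare4.SmoothPoincare4.Theorems.AhHadamardFilling.Negative.IffSmoothPoincare4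

/-!
# Line `fisher-sphere-gauss`: the sorry-free reduction of the crux to its apex and one cited fact
(crux `InformationMetricHadamard.AhHadamardFilling`, item stmt-SmoothPoincare4-6014)

`ahHadamardFilling_of_coreSaddleDominance`: the crux `AhHadamardFilling` follows from
(i) the Literature fact `Literature.Geometry.GaugeTheory.informationMetric_collarAsymptotics`
(Groisser–Murray 1997 Thm. 3.1 with the Donaldson–Taubes collar of `M₁(Σ, g)`), and
(ii) the line's apex (core saddle dominance of the Hellinger map on a smooth connected
Freed–Uhlenbeck-generic model of the collar component, densities positive, information form
positive definite) — through the LANDED stubs I (`stub_fisherRaoMetric`, p126918), K2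
(`stub_hellingerGaussEquation`, p129087), F (`stub_instantonCollarPackage_of`, transfer
p129916/p130685/p131421) and T (`stub_collarEndHadamard`, p126043). This is the line's kernel-checked
terminal certificate: the skeleton is closed modulo {apex, cited fact}.

`smoothPoincare4_of_coreSaddleDominance`: composed with `Negative.ahHadamardFilling_iff_smoothPoincare4`
(p127185), the apex is SUMMIT-STRENGTH modulo the cited fact — proving it proves the smooth
4-dimensional Poincaré conjecture.

References: D. Groisser, M. K. Murray, Ann. Global Anal. Geom. 15 (1997), Thm. 3.1; N. Hitchin, *The
geometry and topology of moduli spaces* (1990); J. M. Lee, *Riemannian Manifolds* (2018), Thm. 8.5.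
-/

noncomputable section

-- the prescribed namespace `Summit.<P>.<Sub>.…` duplicates `SmoothPoincare4` (P = Sub)
set_option linter.dupNamespace false

open scoped Manifold ContDiff Topology ENNReal NNReal
open Set Function MeasureTheory Topology

namespace Summit.SmoothPoincare4.SmoothPoincare4.Cruxes.AhHadamardFilling.FisherSphereGauss

open Literature.Topology.FourManifolds (HomotopySphere)
open Literature.Geometry.Lorentzian (PseudoRiemannianMetric riemannianMeasure)
open Literature.Geometry.GaugeTheory (AsdModuliSpace IsFreedUhlenbeckGeneric
  informationMetric_collarAsymptotics)

/-- Cauchy–Schwarz for a positive semi-definite symmetric continuous bilinear form: the Gram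
determinant of two vectors is non-negative (discriminant of `t ↦ B(X + tY, X + tY) ≥ 0`). Used to pass
from `Rm(X,Y,Y,X) ≤ 0` to the tree's normalised `sectionalCurvature ≤ 0`. [folklore] -/
theorem gram_nonneg_psd {V : Type*} [AddCommGroup V] [Module ℝ V] [TopologicalSpace V]
    (B : V →L[ℝ] V →L[ℝ] ℝ) (hsymm : ∀ v w, B v w = B w v) (hnn : ∀ v, 0 ≤ B v v) (X Y : V) :
    0 ≤ B X X * B Y Y - B X Y ^ 2 := by
  have hquad : ∀ t : ℝ, 0 ≤ B Y Y * (t * t) + (2 * B X Y) * t + B X X := by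
    intro t
    have h := hnn (X + t • Y)
    have hexp : B (X + t • Y) (X + t • Y) = B Y Y * (t * t) + (2 * B X Y) * t + B X X := by
      simp only [map_add, map_smul, add_apply, FunLike.coe_smul, Pi.smul_apply, smul_eq_mul, hsymm Y X]
      ring
    rw [hexp] at h
    exact h
  have hd := discrim_le_zero hquad
  rw [discrim] at hd
  nlinarith [hd]

/-- **Reduction of the crux to the apex of line `fisher-sphere-gauss` and the cited Groisser–Murray fact (sorry-free).** For the given homotopy 4-sphere `Σ`:
the apex supplies the conformal class `g`, the smooth connected model `ι : W → M₁(Σ, g)` of the collar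
component, positivity of the densities, nondegeneracy of `g_I` and saddle dominance; the Hellinger map
`θ = 2√ρ` is then jointly smooth; stub I realises `g_I` as a Riemannian `PseudoRiemannianMetric` `G`;
stub F supplies the Donaldson–Taubes collar `Φ`, the constant `c` and every collar / `C⁰`-asymptotic
clause (stated for `𝓘`, rewritten to `G.val`); stub K2 (Gauss equation) with the apex's inequality gives
`Rm(X,Y,Y,X) ≤ 0`, and Cauchy–Schwarz for `G_w` gives `sec ≤ 0` in the tree's normalisation; stub T
turns connectedness + `sec ≤ 0` + the collar into completeness and simple connectivity. Hypotheses: `hGM` = the Literature fact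
`informationMetric_collarAsymptotics` (GM 1997 Thm. 3.1 with the Donaldson–Taubes collar); `hapex` = the
registered apex `stub_coreSaddleDominance` verbatim (core saddle dominance of the Hellinger map of a smooth
connected Freed–Uhlenbeck-generic model of the collar component, with `ρ > 0` and `g_I` positive definite).
[cite: GroisserMurray1997, Thm. 3.1] -/
theorem ahHadamardFilling_of_coreSaddleDominance (hGM : informationMetric_collarAsymptotics)
    (hapex : ∀ (S : HomotopySphere 4) [Nonempty S.carrier],
      ∃ (g : PseudoRiemannianMetric (𝓡 4) ∞ (EuclideanSpace ℝ (Fin 4)) (TangentSpace (𝓡 4) : S.carrier → Type _))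
        (hg : g.IsRiemannian)
        (W : Type) (_ : TopologicalSpace W) (_ : T2Space W) (_ : SecondCountableTopology W)
          (_ : ChartedSpace (EuclideanSpace ℝ (Fin 5)) W) (_ : IsManifold (𝓡 5) ∞ W) (_ : ConnectedSpace W)
          (ι : W → AsdModuliSpace g S.orientation 1),
          IsFreedUhlenbeckGeneric g S.orientation 1 ∧
          IsModuliModel ι ∧
          (∀ (w : W) (x : S.carrier), 0 < (ι w).density g x) ∧
          (∀ (w : W) (X : EuclideanSpace ℝ (Fin 5)), X ≠ 0 → 0 < fisherForm g hg (hellinger ι) w X X) ∧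
          (∀ (w : W) (X Y : EuclideanSpace ℝ (Fin 5)) (hXX hXY hYY : S.carrier → ℝ),
            IsNormalPart g hg (hellinger ι) w X X hXX → IsNormalPart g hg (hellinger ι) w X Y hXY →
            IsNormalPart g hg (hellinger ι) w Y Y hYY → 0 ≤ saddleForm g hg hXX hXY hYY)) :
    Summit.SmoothPoincare4.SmoothPoincare4.Theses.InformationMetricHadamard.AhHadamardFilling := by
  intro S
  -- the cross-section is nonempty (it is homotopy equivalent to `S⁴`)
  haveI : Nonempty S.carrier := by
    obtain ⟨e⟩ := S.nonempty_homotopyEquiv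
    obtain ⟨p, hp⟩ : (Metric.sphere (0 : EuclideanSpace ℝ (Fin 5)) 1).Nonempty :=
      NormedSpace.sphere_nonempty.2 zero_le_one
    exact ⟨e.invFun ⟨p, hp⟩⟩
  -- APEX: conformal class, model of the collar component, positivity, nondegeneracy, saddle dominance
  obtain ⟨g, hg, W, i₁, i₂, i₃, i₄, i₅, i₆, ι, hgen, hmod, hρ, hpos, hSD⟩ := hapex S
  -- the Hellinger map is jointly smooth (`√` is smooth on `(0, ∞)`)
  have hθ : ContMDiff ((𝓡 5).prod (𝓡 4)) 𝓘(ℝ, ℝ) ∞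
      (fun p : W × S.carrier ↦ hellinger ι p.1 p.2) := by
    intro p
    have hρs : ContMDiffAt ((𝓡 5).prod (𝓡 4)) 𝓘(ℝ, ℝ) ∞
        (fun q : W × S.carrier ↦ (ι q.1).density g q.2) p := hmod.2.2.2 p
    have h2 : ContDiffAt ℝ ∞ (fun r : ℝ ↦ 2 * Real.sqrt r) ((ι p.1).density g p.2) :=
      contDiffAt_const.mul (Real.contDiffAt_sqrt (hρ p.1 p.2).ne')
    exact h2.comp_contMDiffAt (f := fun q : W × S.carrier ↦ (ι q.1).density g q.2) hρs
  -- I: the information metric as a Riemannian `PseudoRiemannianMetric`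
  obtain ⟨G, hG, hGval⟩ := stub_fisherRaoMetric S.carrier g hg W (hellinger ι) hθ hpos
  -- F: the Donaldson–Taubes collar and the Groisser–Murray asymptotics
  obtain ⟨c, Φ, hc, hsm, hinj, hco, hcl, hasymI⟩ :=
    stub_instantonCollarPackage_of hGM S g hg hgen W ι hmod hρ hpos
  have hasym : ∀ ε : ℝ, 0 < ε → ∃ t ∈ Ioo (0 : ℝ) 1, ∀ (x : S.carrier) (l : ℝ), l ∈ Ioo (0 : ℝ) t →
      ∀ (v : TangentSpace (𝓡 4) x) (s : ℝ),
        |G.val (Φ (x, l)) (mfderiv ((𝓡 4).prod 𝓘(ℝ, ℝ)) (𝓡 5) Φ (x, l) (v, s))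
            (mfderiv ((𝓡 4).prod 𝓘(ℝ, ℝ)) (𝓡 5) Φ (x, l) (v, s)) -
          c * (s ^ 2 + g.val x v v) / l ^ 2| ≤ ε * (c * (s ^ 2 + g.val x v v) / l ^ 2) := by
    intro ε hε
    obtain ⟨t, ht, h⟩ := hasymI ε hε
    refine ⟨t, ht, fun x l hl v s ↦ ?_⟩
    rw [hGval]
    exact h x l hl v s
  -- K2 + APEX: `Rm(X,Y,Y,X) = -saddleForm ≤ 0`, hence `sec ≤ 0`
  have hsec : ∀ cov, G.IsLeviCivita cov →
      ∀ (x : W) (X Y : TangentSpace (𝓡 5) x), G.sectionalCurvature cov x X Y ≤ 0 := by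
    intro cov hcov w X Y
    obtain ⟨hXX, hXY, hYY, nXX, nXY, nYY, hgauss⟩ :=
      stub_hellingerGaussEquation S.carrier g hg W (hellinger ι) hθ G hG hGval cov hcov w X Y
    have hsd : 0 ≤ saddleForm g hg hXX hXY hYY := hSD w X Y hXX hXY hYY nXX nXY nYY
    have hRm : G.curvatureForm cov w X Y Y X ≤ 0 := by rw [hgauss]; linarith
    have hden : 0 ≤ G.val w X X * G.val w Y Y - G.val w X Y ^ 2 :=
      gram_nonneg_psd (G.val w) (G.symm w) (fun v ↦ by
        by_cases hv : v = 0
        · subst hv; simp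
        · exact (hG w v hv).le) X Y
    rw [PseudoRiemannianMetric.sectionalCurvature]
    exact div_nonpos_iff.2 (Or.inr ⟨hRm, hden⟩)
  -- T: completeness and simple connectivity of the connected `sec ≤ 0` model with its collar
  obtain ⟨hcpt, hsc⟩ := stub_collarEndHadamard S g hg W G hG c Φ hc hsec hsm hinj hco hcl hasym
  exact ⟨g, hg, W, i₁, i₂, i₃, i₄, i₅, hsc, G, hG, c, Φ, hc, hcpt, hsec, hsm, hinj, hco, hcl, hasym⟩


/-- **The apex of line `fisher-sphere-gauss` is summit-strength modulo the cited Groisser–Murray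
fact**: core saddle dominance of the Hellinger map of the charge-one collar component (for every
homotopy 4-sphere, some generic conformal class) implies the smooth 4-dimensional Poincaré conjecture —
by `ahHadamardFilling_of_coreSaddleDominance` and the crux ↔ summit certificate
`Negative.ahHadamardFilling_iff_smoothPoincare4` (p127185). [cite: GroisserMurray1997, Thm. 3.1] -/
theorem smoothPoincare4_of_coreSaddleDominance (hGM : informationMetric_collarAsymptotics)
    (hapex : ∀ (S : HomotopySphere 4) [Nonempty S.carrier],
      ∃ (g : PseudoRiemannianMetric (𝓡 4) ∞ (EuclideanSpace ℝ (Fin 4)) (TangentSpace (𝓡 4) : S.carrier → Type _))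
        (hg : g.IsRiemannian)
        (W : Type) (_ : TopologicalSpace W) (_ : T2Space W) (_ : SecondCountableTopology W)
          (_ : ChartedSpace (EuclideanSpace ℝ (Fin 5)) W) (_ : IsManifold (𝓡 5) ∞ W) (_ : ConnectedSpace W)
          (ι : W → AsdModuliSpace g S.orientation 1),
          IsFreedUhlenbeckGeneric g S.orientation 1 ∧
          IsModuliModel ι ∧
          (∀ (w : W) (x : S.carrier), 0 < (ι w).density g x) ∧
          (∀ (w : W) (X : EuclideanSpace ℝ (Fin 5)), X ≠ 0 → 0 < fisherForm g hg (hellinger ι) w X X) ∧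
          (∀ (w : W) (X Y : EuclideanSpace ℝ (Fin 5)) (hXX hXY hYY : S.carrier → ℝ),
            IsNormalPart g hg (hellinger ι) w X X hXX → IsNormalPart g hg (hellinger ι) w X Y hXY →
            IsNormalPart g hg (hellinger ι) w Y Y hYY → 0 ≤ saddleForm g hg hXX hXY hYY)) :
    _root_.SmoothPoincare4 :=
  Summit.SmoothPoincare4.SmoothPoincare4.Theorems.AhHadamardFilling.Negative.ahHadamardFilling_iff_smoothPoincare4.1
    (ahHadamardFilling_of_coreSaddleDominance hGM hapex)

end Summit.SmoothPoincare4.SmoothPoincare4.Cruxes.AhHadamardFilling.FisherSphereGauss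

end
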